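import Summits.AnomalousDissipation.AnomalousDissipation.Theorems.SoloBlindStressPinning

/-!
# Solo (blind) — the Doering–Foias energy floor along Leray–Hopf solutions, with the
# semidefinite constant

Reproduction, for GENERAL smooth mean-zero forces `f` on `𝕋³` and GENERAL smooth divergence-free
multipliers `Ψ`, of the Doering–Foias amplitude inequality (Doering & Foias, *Energy dissipation
in body-forced turbulence*, J. Fluid Mech. 467 (2002) 289–306, §3; Alexakis & Doering, Phys.
Lett. A 359 (2006), eq. (F1a); carried in the tree as the NAMED FACT
`Literature.Analysis.FluidPDE.DoeringFoias2002_amplitude_le`, there at all scales `ℓ = 1/n` for a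
forcing shape): test the momentum equation of a global Leray–Hopf weak solution of `NS_ν(f)`
against `Ψ`, Cesàro-average in time, let the boundary term go (`‖u(T)‖₂ = O(√T)`), and bound the
Reynolds-stress pairing and the viscous pairing:

  `∫⟪f,Ψ⟫ ≤ c · ⟨‖u‖₂²⟩ + ν ‖ΔΨ‖₂ ⟨‖u‖₂²⟩^{1/2}`        (`forcePairing_le_of_meanEnergy_le`)

for every global Leray–Hopf solution, where `⟨‖u‖₂²⟩ = meanEnergy u` (the `limsup` Cesàro mean of
`Literature.Analysis.FluidPDE.ZerothLaw`) and — the one sharpening over the printed constant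
`‖∇Ψ‖_∞` — `c ≥ 0` is any SEMIDEFINITE bound `v·(∇Ψ(x))v ≥ −c‖v‖²` (`∀ x v`), i.e.
`sym ∇Ψ ⪰ −c·I` pointwise (only the symmetric part of `∇Ψ`, and only its negative part, is seen
by the Reynolds stress `u⊗u ⪰ 0`). Consequences:

* `forcePairing_le_strain_mul_of_family`: along ANY vanishing-viscosity family of global
  Leray–Hopf solutions of `NS_{νⱼ}(f)` (one fixed `f`) with `meanEnergy (u j) ≤ E`:
  `∫⟪f,Ψ⟫ ≤ c·E` — the energy bound `E` in the statement `ZerothLaw` can never be smaller than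
  the INERTIAL ENERGY FLOOR `m(f) = sup_Ψ ∫⟪f,Ψ⟫ / c(Ψ) > 0` (take `Ψ = f`), uniformly in the
  viscosity and with no hypothesis on data, uniqueness or regularity;
* `forcePairing_le_frobenius_mul_of_family`: the same with the printed constant, `c = M` for
  `|∇Ψ| ≤ M` (Frobenius norm), via `abs`-Cauchy–Schwarz pointwise.

Of the two uniform-in-`ν` floors (energy, dissipation) the first is a theorem of the weak
formulation alone; the zeroth law (`Summit.AnomalousDissipation`) is the second.
[cite: DoeringFoias2002, §3] [cite: AlexakisDoering2006PLA, eq. (F1a)] [cite: Temam1984, Ch. III §1.1 (1.25)]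
-/

open MeasureTheory Filter Topology Set UnitAddTorus
open scoped ENNReal NNReal InnerProductSpace

noncomputable section

namespace Summit.AnomalousDissipation.AnomalousDissipation.Theorems

open Literature.Analysis.FunctionSpaces Literature.Analysis.FunctionSpaces.Torus
open Literature.Analysis.FluidPDE

variable {ν c T : ℝ} {f Ψ u₀ : UnitAddTorus (Fin 3) → EuclideanSpace ℝ (Fin 3)}
  {u : ℝ → UnitAddTorus (Fin 3) → EuclideanSpace ℝ (Fin 3)}

/-! ### The viscous pairing and the slice bookkeeping -/

/-- The Cesàro means `⟨V⟩_T` of the viscous pairing `V(s) = ∫⟪u(s), ΔΨ⟫`. [folklore] -/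
def laplacePairingMean (Ψ : UnitAddTorus (Fin 3) → EuclideanSpace ℝ (Fin 3))
    (u : ℝ → UnitAddTorus (Fin 3) → EuclideanSpace ℝ (Fin 3)) : ℝ → ℝ :=
  timeMean fun s => ∫ x, ⟪u s x, Torus.laplacian Ψ x⟫_ℝ

/-- The flux integrand of an `L²` slice splits: `∫ (⟪U,(U·∇)Ψ⟫ + ν⟪U,ΔΨ⟫ + ⟪f,Ψ⟫) =
∫⟪U,(U·∇)Ψ⟫ + ν ∫⟪U,ΔΨ⟫ + ∫⟪f,Ψ⟫`. [folklore] -/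
theorem sliceFlux_split {U : UnitAddTorus (Fin 3) → EuclideanSpace ℝ (Fin 3)}
    (hU : MemLp U 2 volume) (hf : IsSmooth f) (hΨ : IsSmooth Ψ) (ν : ℝ) :
    ∫ x, (⟪U x, Torus.convect U Ψ x⟫_ℝ + ν * ⟪U x, Torus.laplacian Ψ x⟫_ℝ + ⟪f x, Ψ x⟫_ℝ) =
      (∫ x, ⟪U x, Torus.convect U Ψ x⟫_ℝ) + ν * (∫ x, ⟪U x, Torus.laplacian Ψ x⟫_ℝ) +
        ∫ x, ⟪f x, Ψ x⟫_ℝ := by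
  have h1 : Integrable (fun x => ⟪U x, Torus.convect U Ψ x⟫_ℝ) volume :=
    Torus.integrable_inner_convect_self hU hΨ
  have h2 : Integrable (fun x => ν * ⟪U x, Torus.laplacian Ψ x⟫_ℝ) volume :=
    (Torus.integrable_inner_of_continuous (hU.integrable one_le_two)
      hΨ.laplacian.continuous).const_mul ν
  have h3 : Integrable (fun x => ⟪f x, Ψ x⟫_ℝ) volume :=
    Torus.integrable_inner_of_continuous hf.integrable hΨ.continuous
  have h12 : Integrable (fun x => ⟪U x, Torus.convect U Ψ x⟫_ℝ +
      ν * ⟪U x, Torus.laplacian Ψ x⟫_ℝ) volume := h1.add h2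
  rw [integral_add h12 h3, integral_add h1 h2, integral_const_mul]

/-- The viscous pairing `s ↦ ∫⟪u(s), ΔΨ⟫` is integrable on `(0, T)`. [folklore] -/
theorem lh_integrableOn_laplacePairing (h : Torus.IsLerayHopfOn T ν (fun _ => f) u₀ u)
    (hΨ : IsSmooth Ψ) :
    IntegrableOn (fun s => ∫ x, ⟪u s x, Torus.laplacian Ψ x⟫_ℝ) (Ioo 0 T) :=
  h.integrableOn_integral_inner hΨ.laplacian.continuous

/-- The Reynolds-stress moment `s ↦ A(s) = ∫⟪u(s),(u(s)·∇)Ψ⟫` is integrable on `(0, T)` for every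
smooth `Ψ` (no potential relation needed). [folklore] -/
theorem lh_integrableOn_stressMoment' (h : Torus.IsLerayHopfOn T ν (fun _ => f) u₀ u)
    (hf : IsSmooth f) (hΨ : IsSmooth Ψ) : IntegrableOn (stressMoment Ψ u) (Ioo 0 T) := by
  have hFl := h.integrableOn_flux
    (Literature.Analysis.FluidPDE.aestronglyMeasurable_stLift_steady hf.continuous _)
    (Literature.Analysis.FluidPDE.lintegral_Ioo_lintegral_enorm_sq_steady_lt_top (hf.memLp 2) T)
    hΨ
  have hV := lh_integrableOn_laplacePairing h hΨ
  haveI : IsFiniteMeasure (volume.restrict (Ioo (0 : ℝ) T)) :=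
    ⟨by rw [Measure.restrict_apply_univ]; exact measure_Ioo_lt_top⟩
  have hc : IntegrableOn (fun _ : ℝ => ∫ x, ⟪f x, Ψ x⟫_ℝ) (Ioo 0 T) := integrable_const _
  have hsum : IntegrableOn (fun s =>
      (∫ x, (⟪u s x, Torus.convect (u s) Ψ x⟫_ℝ + ν * ⟪u s x, Torus.laplacian Ψ x⟫_ℝ +
        ⟪f x, Ψ x⟫_ℝ)) - ν * (∫ x, ⟪u s x, Torus.laplacian Ψ x⟫_ℝ) - ∫ x, ⟪f x, Ψ x⟫_ℝ)
      (Ioo 0 T) :=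
    (hFl.sub (hV.const_mul ν)).sub hc
  refine hsum.congr_fun (fun s hs => ?_) measurableSet_Ioo
  dsimp only
  rw [sliceFlux_split (h.memLp s (Ioo_subset_Icc_self hs)) hf hΨ ν]
  unfold stressMoment
  ring

/-! ### The Cesàro identity for a general multiplier -/

/-- **The Cesàro multiplier identity with its boundary term** (`T > 0`): for every smooth
divergence-free `Ψ`,
`T⁻¹ (∫⟪u(T),Ψ⟫ − ∫⟪u₀,Ψ⟫) = ⟨A⟩_T + ν ⟨V⟩_T + ∫⟪f,Ψ⟫`
(`A = ∫ u⊗u : ∇Ψ`, `V = ∫⟪u, ΔΨ⟫`). [folklore; cite: Temam1984, Ch. III §1.1 (1.25)] -/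
theorem multiplier_window_eq (hu : Torus.IsGlobalLerayHopf ν (fun _ => f) u₀ u)
    (hf : IsSmooth f) (hΨ : IsSmooth Ψ) (hΨdiv : IsDivFree Ψ) (hT : 0 < T) :
    T⁻¹ * ((∫ x, ⟪u T x, Ψ x⟫_ℝ) - ∫ x, ⟪u₀ x, Ψ x⟫_ℝ) =
      stressMean Ψ u T + ν * laplacePairingMean Ψ u T + ∫ x, ⟪f x, Ψ x⟫_ℝ := by
  have h := hu T hT
  have key := h.integral_inner_eq_add_setIntegral hT
    (Literature.Analysis.FluidPDE.aestronglyMeasurable_stLift_steady hf.continuous _)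
    (Literature.Analysis.FluidPDE.lintegral_Ioo_lintegral_enorm_sq_steady_lt_top (hf.memLp 2) T)
    hΨ hΨdiv ⟨hT, le_rfl⟩
  have hA := integrableOn_Ioc_of_Ioo (lh_integrableOn_stressMoment' h hf hΨ) le_rfl
  have hV := integrableOn_Ioc_of_Ioo (lh_integrableOn_laplacePairing h hΨ) le_rfl
  haveI : IsFiniteMeasure (volume.restrict (Ioc (0 : ℝ) T)) :=
    ⟨by rw [Measure.restrict_apply_univ]; exact measure_Ioc_lt_top⟩
  have hc : IntegrableOn (fun _ : ℝ => ∫ x, ⟪f x, Ψ x⟫_ℝ) (Ioc 0 T) := integrable_const _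
  have hsplit : (∫ s in Ioc 0 T, ∫ x, (⟪u s x, Torus.convect (u s) Ψ x⟫_ℝ +
      ν * ⟪u s x, Torus.laplacian Ψ x⟫_ℝ + ⟪f x, Ψ x⟫_ℝ)) =
      ∫ s in Ioc 0 T, (stressMoment Ψ u s + ν * (∫ x, ⟪u s x, Torus.laplacian Ψ x⟫_ℝ) +
        ∫ x, ⟪f x, Ψ x⟫_ℝ) := by
    refine setIntegral_congr_fun measurableSet_Ioc fun s hs => ?_
    rw [sliceFlux_split (h.memLp s ⟨hs.1.le, hs.2⟩) hf hΨ ν]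
    rfl
  have hsum : (∫ s in Ioc 0 T, (stressMoment Ψ u s + ν * (∫ x, ⟪u s x, Torus.laplacian Ψ x⟫_ℝ) +
        ∫ x, ⟪f x, Ψ x⟫_ℝ)) =
      (∫ s in Ioc 0 T, stressMoment Ψ u s) +
        ν * (∫ s in Ioc 0 T, ∫ x, ⟪u s x, Torus.laplacian Ψ x⟫_ℝ) + T * ∫ x, ⟪f x, Ψ x⟫_ℝ := by
    have hV' : IntegrableOn (fun s => ν * ∫ x, ⟪u s x, Torus.laplacian Ψ x⟫_ℝ) (Ioc 0 T) :=
      hV.const_mul ν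
    have hAV : IntegrableOn (fun s => stressMoment Ψ u s +
        ν * ∫ x, ⟪u s x, Torus.laplacian Ψ x⟫_ℝ) (Ioc 0 T) := hA.add hV'
    rw [integral_add hAV hc, integral_add hA hV', integral_const_mul, setIntegral_const,
      Real.volume_real_Ioc_of_le hT.le, sub_zero, smul_eq_mul]
  have hTinv : T⁻¹ * T = 1 := inv_mul_cancel₀ hT.ne'
  unfold stressMean laplacePairingMean timeMean
  rw [intervalIntegral.integral_of_le hT.le, intervalIntegral.integral_of_le hT.le, key, hsplit,
    hsum, add_sub_cancel_left]
  linear_combination (∫ x, ⟪f x, Ψ x⟫_ℝ) * hTinv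

/-! ### The two pairings are controlled by the energy -/

/-- **Reynolds stress against a semidefinite strain.** If `v·(∇Ψ(x))v ≥ −c‖v‖²` for all `x, v`
(`sym ∇Ψ ⪰ −c I`), then `∫⟪U,(U·∇)Ψ⟫ ≥ −c ∫‖U‖²` for every `U ∈ L²`. [folklore] -/
theorem stressMoment_ge_of_semidefinite {U : UnitAddTorus (Fin 3) → EuclideanSpace ℝ (Fin 3)}
    (hU : MemLp U 2 volume) (hΨ : IsSmooth Ψ)
    (hc : ∀ (x : UnitAddTorus (Fin 3)) (v : EuclideanSpace ℝ (Fin 3)),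
      -(c * ‖v‖ ^ 2) ≤ ⟪v, Torus.convect (fun _ => v) Ψ x⟫_ℝ) :
    -(c * ∫ x, ‖U x‖ ^ 2) ≤ ∫ x, ⟪U x, Torus.convect U Ψ x⟫_ℝ := by
  rw [← integral_const_mul, ← integral_neg]
  exact integral_mono ((hU.integrable_norm_pow two_ne_zero).const_mul c).neg
    (Torus.integrable_inner_convect_self hU hΨ) fun x => hc x (U x)

/-- The semidefinite constant from a Frobenius bound: `|∇Ψ| ≤ M` pointwise gives
`v·(∇Ψ(x))v ≥ −M‖v‖²`. [folklore] -/
theorem semidefinite_of_frobenius (hΨ : IsSmooth Ψ) {M : ℝ}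
    (hM : ∀ x, Real.sqrt (∑ i, ‖Torus.partialDeriv i Ψ x‖ ^ 2) ≤ M)
    (x : UnitAddTorus (Fin 3)) (v : EuclideanSpace ℝ (Fin 3)) :
    -(M * ‖v‖ ^ 2) ≤ ⟪v, Torus.convect (fun _ => v) Ψ x⟫_ℝ := by
  have h1 := abs_real_inner_le_norm v (Torus.convect (fun _ => v) Ψ x)
  have h2 := Torus.norm_convect_le_norm_mul_sqrt (hΨ.isContDiff (by simp)) (fun _ => v) x
  have h3 : |⟪v, Torus.convect (fun _ => v) Ψ x⟫_ℝ| ≤ M * ‖v‖ ^ 2 :=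
    calc |⟪v, Torus.convect (fun _ => v) Ψ x⟫_ℝ| ≤ ‖v‖ * ‖Torus.convect (fun _ => v) Ψ x‖ := h1
      _ ≤ ‖v‖ * (‖v‖ * Real.sqrt (∑ i, ‖Torus.partialDeriv i Ψ x‖ ^ 2)) :=
          mul_le_mul_of_nonneg_left h2 (norm_nonneg _)
      _ ≤ ‖v‖ * (‖v‖ * M) :=
          mul_le_mul_of_nonneg_left (mul_le_mul_of_nonneg_left (hM x) (norm_nonneg _))
            (norm_nonneg _)
      _ = M * ‖v‖ ^ 2 := by ring
  linarith [(abs_le.1 h3).1]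

/-- **`⟨A⟩_T ≥ −c ⟨‖u‖²⟩_T`** along a global Leray–Hopf solution (`T > 0`). [folklore] -/
theorem stressMean_ge (hu : Torus.IsGlobalLerayHopf ν (fun _ => f) u₀ u) (hf : IsSmooth f)
    (hΨ : IsSmooth Ψ)
    (hc : ∀ (x : UnitAddTorus (Fin 3)) (v : EuclideanSpace ℝ (Fin 3)),
      -(c * ‖v‖ ^ 2) ≤ ⟪v, Torus.convect (fun _ => v) Ψ x⟫_ℝ) (hT : 0 < T) :
    -(c * energyMean u T) ≤ stressMean Ψ u T := by
  have hA := integrableOn_Ioc_of_Ioo (lh_integrableOn_stressMoment' (hu T hT) hf hΨ) le_rfl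
  have hE : IntegrableOn (fun τ => ∫ x, ‖u τ x‖ ^ 2) (Ioc 0 T) :=
    hu.integrableOn_integral_norm_sq hT
  have hmono : ∫ s in Ioc 0 T, -(c * ∫ x, ‖u s x‖ ^ 2) ≤ ∫ s in Ioc 0 T, stressMoment Ψ u s :=
    setIntegral_mono_on (hE.const_mul c).neg hA measurableSet_Ioc fun s hs =>
      stressMoment_ge_of_semidefinite ((hu T hT).memLp s ⟨hs.1.le, hs.2⟩) hΨ hc
  rw [integral_neg, integral_const_mul] at hmono
  unfold stressMean energyMean timeMean
  rw [intervalIntegral.integral_of_le hT.le, intervalIntegral.integral_of_le hT.le]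
  have hTi : 0 ≤ T⁻¹ := inv_nonneg.2 hT.le
  calc -(c * (T⁻¹ * ∫ s in Ioc 0 T, ∫ x, ‖u s x‖ ^ 2))
      = T⁻¹ * -(c * ∫ s in Ioc 0 T, ∫ x, ‖u s x‖ ^ 2) := by ring
    _ ≤ T⁻¹ * ∫ s in Ioc 0 T, stressMoment Ψ u s := mul_le_mul_of_nonneg_left hmono hTi

/-- **Cesàro pairing against Cesàro energy**: `|⟨∫⟪u,g⟫⟩_T| ≤ ‖g‖₂ √⟨‖u‖²⟩_T` for every
smooth `g` (`T > 0`; pointwise Cauchy–Schwarz, then `√·` is concave). [cite: DoeringFoias2002, §2] -/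
theorem abs_timeMean_pairing_le (hu : Torus.IsGlobalLerayHopf ν (fun _ => f) u₀ u)
    {g : UnitAddTorus (Fin 3) → EuclideanSpace ℝ (Fin 3)} (hg : IsSmooth g) (hT : 0 < T) :
    |timeMean (fun t => ∫ x, ⟪u t x, g x⟫_ℝ) T| ≤
      Real.sqrt (∫ x, ‖g x‖ ^ 2) * Real.sqrt (energyMean u T) := by
  set E : ℝ → ℝ := fun τ => ∫ x, ‖u τ x‖ ^ 2 with hEdef
  set P : ℝ → ℝ := fun τ => ∫ x, ⟪u τ x, g x⟫_ℝ with hPdef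
  set A : ℝ := Real.sqrt (∫ x, ‖g x‖ ^ 2) with hA
  have hA0 : 0 ≤ A := Real.sqrt_nonneg _
  have hE0 : ∀ τ, 0 ≤ E τ := fun τ => integral_nonneg fun _ => sq_nonneg _
  have hEint : IntervalIntegrable E volume 0 T :=
    (intervalIntegrable_iff_integrableOn_Ioc_of_le hT.le).2 (hu.integrableOn_integral_norm_sq hT)
  have hPint : IntervalIntegrable P volume 0 T := by
    rw [intervalIntegrable_iff_integrableOn_Ioc_of_le hT.le]
    exact (integrableOn_Ioc_iff_integrableOn_Ioo).mpr
      ((hu T hT).integrableOn_integral_inner hg.continuous)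
  change |timeMean P T| ≤ A * Real.sqrt (timeMean E T)
  refine le_mul_sqrt_of_forall_pos hA0 (timeMean_nonneg hE0 hT.le) fun a ha => ?_
  have hmono : ∫ τ in (0 : ℝ)..T, |P τ| ≤ ∫ τ in (0 : ℝ)..T, A * (E τ / (2 * a) + a / 2) := by
    refine intervalIntegral.integral_mono_on hT.le hPint.abs
      (((hEint.div_const _).add _root_.intervalIntegrable_const).const_mul A) fun τ hτ => ?_
    have hcs : |P τ| ≤ A * Real.sqrt (E τ) := by
      have h := Literature.Analysis.FluidPDE.abs_integral_inner_le_sqrt_mul_sqrt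
        (hu.memLp_two hτ.1) (hg.memLp 2)
      rw [mul_comm] at h
      exact h
    refine hcs.trans (mul_le_mul_of_nonneg_left ?_ hA0)
    have hsq : Real.sqrt (E τ) ^ 2 = E τ := Real.sq_sqrt (hE0 τ)
    have hid : E τ / (2 * a) + a / 2 = (Real.sqrt (E τ) ^ 2 + a ^ 2) / (2 * a) := by
      rw [hsq]
      field_simp
    rw [hid, le_div_iff₀ (by positivity)]
    nlinarith [sq_nonneg (Real.sqrt (E τ) - a)]
  rw [intervalIntegral.integral_const_mul,
    intervalIntegral.integral_add (hEint.div_const _) _root_.intervalIntegrable_const,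
    intervalIntegral.integral_div, intervalIntegral.integral_const, sub_zero, smul_eq_mul] at hmono
  have habs : |∫ τ in (0 : ℝ)..T, P τ| ≤ ∫ τ in (0 : ℝ)..T, |P τ| :=
    intervalIntegral.abs_integral_le_integral_abs hT.le
  unfold timeMean
  rw [abs_mul, abs_of_pos (inv_pos.2 hT)]
  calc T⁻¹ * |∫ τ in (0 : ℝ)..T, P τ|
      ≤ T⁻¹ * (A * ((∫ τ in (0 : ℝ)..T, E τ) / (2 * a) + T * (a / 2))) :=
        mul_le_mul_of_nonneg_left (habs.trans hmono) (inv_nonneg.2 hT.le)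
    _ = A * (T⁻¹ * (∫ τ in (0 : ℝ)..T, E τ) / (2 * a) + a / 2) := by
        field_simp

/-- `|⟨V⟩_T| ≤ ‖ΔΨ‖₂ √⟨‖u‖²⟩_T`. [folklore] -/
theorem abs_laplacePairingMean_le (hu : Torus.IsGlobalLerayHopf ν (fun _ => f) u₀ u)
    (hΨ : IsSmooth Ψ) (hT : 0 < T) :
    |laplacePairingMean Ψ u T| ≤
      Real.sqrt (∫ x, ‖Torus.laplacian Ψ x‖ ^ 2) * Real.sqrt (energyMean u T) :=
  abs_timeMean_pairing_le hu hΨ.laplacian hT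

/-! ### The energy floor -/

/-- **The amplitude inequality, Cesàro form**: for every `δ > 0`, eventually in `T`,
`∫⟪f,Ψ⟫ ≤ c ⟨‖u‖²⟩_T + ν ‖ΔΨ‖₂ √⟨‖u‖²⟩_T + δ` (`ν > 0`, `sym ∇Ψ ⪰ −cI`).
[cite: DoeringFoias2002, §3] -/
theorem forcePairing_le_eventually (hu : Torus.IsGlobalLerayHopf ν (fun _ => f) u₀ u)
    (hν : 0 < ν) (hf : IsSmooth f) (hf0 : HasZeroMean f) (hΨ : IsSmooth Ψ) (hΨdiv : IsDivFree Ψ)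
    (hc : ∀ (x : UnitAddTorus (Fin 3)) (v : EuclideanSpace ℝ (Fin 3)),
      -(c * ‖v‖ ^ 2) ≤ ⟪v, Torus.convect (fun _ => v) Ψ x⟫_ℝ)
    {δ : ℝ} (hδ : 0 < δ) :
    ∀ᶠ T : ℝ in atTop, ∫ x, ⟪f x, Ψ x⟫_ℝ ≤
      c * energyMean u T +
        ν * Real.sqrt (∫ x, ‖Torus.laplacian Ψ x‖ ^ 2) * Real.sqrt (energyMean u T) + δ := by
  filter_upwards [eventually_abs_stressBoundary_le hu hν hf hf0 hΨ hδ,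
    eventually_gt_atTop (0 : ℝ)] with T hb hT
  have e := multiplier_window_eq hu hf hΨ hΨdiv hT
  have hA := stressMean_ge hu hf hΨ hc hT
  obtain ⟨v1, -⟩ := abs_le.1 (abs_laplacePairingMean_le hu hΨ hT)
  obtain ⟨-, b2⟩ := abs_le.1 hb
  have q := mul_le_mul_of_nonneg_left v1 hν.le
  linarith

/-- If `limsup m ≤ E`, `m` eventually bounded, `0 ≤ E`, `η > 0`: eventually `m T ≤ (√E + η)²`. [folklore] -/
theorem eventually_le_sq_sqrt_add {m : ℝ → ℝ} {E η : ℝ} (hE0 : 0 ≤ E) (hη : 0 < η)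
    (hbdd : IsBoundedUnder (· ≤ ·) atTop m) (hE : limsup m atTop ≤ E) :
    ∀ᶠ T in atTop, m T ≤ (Real.sqrt E + η) ^ 2 := by
  have hlt : limsup m atTop < (Real.sqrt E + η) ^ 2 := by
    have h : E < (Real.sqrt E + η) ^ 2 := by
      nlinarith [Real.sq_sqrt hE0, Real.sqrt_nonneg E]
    exact hE.trans_lt h
  filter_upwards [eventually_lt_of_limsup_lt hlt hbdd] with T hT
  exact hT.le

/-- **The Doering–Foias energy floor with the semidefinite constant.** Along every global
Leray–Hopf weak solution of `NS_ν(f)` on `𝕋³` (`ν > 0`, `f` smooth with zero mean), for every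
smooth divergence-free `Ψ` with `sym ∇Ψ ⪰ −c I` (`c ≥ 0`) and every `E ≥ meanEnergy u`:
`∫⟪f,Ψ⟫ ≤ c E + ν ‖ΔΨ‖₂ √E`. [cite: DoeringFoias2002, §3] -/
theorem forcePairing_le_of_meanEnergy_le (hu : Torus.IsGlobalLerayHopf ν (fun _ => f) u₀ u)
    (hν : 0 < ν) (hf : IsSmooth f) (hf0 : HasZeroMean f) (hΨ : IsSmooth Ψ) (hΨdiv : IsDivFree Ψ)
    (hc0 : 0 ≤ c)
    (hc : ∀ (x : UnitAddTorus (Fin 3)) (v : EuclideanSpace ℝ (Fin 3)),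
      -(c * ‖v‖ ^ 2) ≤ ⟪v, Torus.convect (fun _ => v) Ψ x⟫_ℝ)
    {E : ℝ} (hE : meanEnergy u ≤ E) :
    ∫ x, ⟪f x, Ψ x⟫_ℝ ≤ c * E + ν * Real.sqrt (∫ x, ‖Torus.laplacian Ψ x‖ ^ 2) * Real.sqrt E := by
  change limsup (energyMean u) atTop ≤ E at hE
  set L : ℝ := ν * Real.sqrt (∫ x, ‖Torus.laplacian Ψ x‖ ^ 2) with hL
  have hL0 : 0 ≤ L := by positivity
  obtain ⟨K, hK0, hK⟩ := exists_energyMean_le_general hu hν hf hf0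
  have hbddE : IsBoundedUnder (· ≤ ·) atTop (energyMean u) :=
    isBoundedUnder_of_eventually_le ((eventually_ge_atTop (1 : ℝ)).mono hK)
  have hE0 : 0 ≤ E := by
    refine le_trans (le_limsup_of_frequently_le (Eventually.frequently ?_) hbddE) hE
    filter_upwards [eventually_ge_atTop (0 : ℝ)] with T hT
    exact mul_nonneg (inv_nonneg.2 hT) (intervalIntegral.integral_nonneg hT fun t _ =>
      integral_nonneg fun _ => by positivity)
  set s : ℝ := Real.sqrt E with hs
  have hs0 : 0 ≤ s := Real.sqrt_nonneg _
  have hsE : s ^ 2 = E := Real.sq_sqrt hE0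
  refine le_of_forall_pos_le_add fun ε hε => ?_
  -- choose `η ≤ 1` with `(c (2s + 1) + L) η ≤ ε/2`
  set D : ℝ := c * (2 * s + 1) + L with hD
  have hD0 : 0 ≤ D := by positivity
  obtain ⟨η, hη0, hη1, hηD⟩ : ∃ η : ℝ, 0 < η ∧ η ≤ 1 ∧ D * η ≤ ε / 2 := by
    refine ⟨min 1 (ε / 2 / (D + 1)), by positivity, min_le_left _ _, ?_⟩
    calc D * min 1 (ε / 2 / (D + 1)) ≤ (D + 1) * (ε / 2 / (D + 1)) :=
          mul_le_mul (by linarith) (min_le_right _ _) (by positivity) (by positivity)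
      _ = ε / 2 := mul_div_cancel₀ _ (by positivity)
  have hev := forcePairing_le_eventually hu hν hf hf0 hΨ hΨdiv hc (half_pos hε)
  have hsq := eventually_le_sq_sqrt_add hE0 hη0 hbddE hE
  obtain ⟨T, h1, h2⟩ := (hev.and hsq).exists
  -- at this `T`: `E_T ≤ (s + η)²`, `√E_T ≤ s + η`
  have hsqrtT : Real.sqrt (energyMean u T) ≤ s + η :=
    calc Real.sqrt (energyMean u T) ≤ Real.sqrt ((s + η) ^ 2) := Real.sqrt_le_sqrt h2
      _ = s + η := Real.sqrt_sq (by positivity)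
  have i1 : c * energyMean u T ≤ c * (s + η) ^ 2 := mul_le_mul_of_nonneg_left h2 hc0
  have i2 : L * Real.sqrt (energyMean u T) ≤ L * (s + η) := mul_le_mul_of_nonneg_left hsqrtT hL0
  have i3 : c * (s + η) ^ 2 + L * (s + η) ≤ c * E + L * s + D * η := by
    rw [← hsE, hD]
    nlinarith [mul_nonneg hc0 (mul_nonneg hη0.le (sub_nonneg.2 hη1))]
  have h1' : ∫ x, ⟪f x, Ψ x⟫_ℝ ≤ c * energyMean u T + L * Real.sqrt (energyMean u T) + ε / 2 := by
    rw [hL]; linarith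
  calc ∫ x, ⟪f x, Ψ x⟫_ℝ ≤ c * energyMean u T + L * Real.sqrt (energyMean u T) + ε / 2 := h1'
    _ ≤ c * E + L * s + D * η + ε / 2 := by linarith
    _ ≤ c * E + L * s + ε := by linarith
    _ = c * E + ν * Real.sqrt (∫ x, ‖Torus.laplacian Ψ x‖ ^ 2) * Real.sqrt E + ε := by
        rw [hL, hs]

/-! ### Vanishing-viscosity families: the energy bound of `ZerothLaw` sits above a floor -/

/-- **Inertial energy floor for Leray–Hopf families, uniform in the viscosity.** Along any family
of global Leray–Hopf weak solutions `uⱼ` of `NS_{νⱼ}(f)` (`νⱼ > 0`, `νⱼ → 0`, ONE fixed smooth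
mean-zero `f`, arbitrary data) with `meanEnergy (u j) ≤ E` for all `j`: for every smooth
divergence-free `Ψ` with `sym ∇Ψ ⪰ −cI`, `c ≥ 0`,
`∫⟪f,Ψ⟫ ≤ c · E`.
With `Ψ = f`: `E ≥ ‖f‖₂²/c(f) > 0` — the energy clause of `ZerothLaw` is bounded below by the
force alone. [cite: DoeringFoias2002, §3] -/
theorem forcePairing_le_strain_mul_of_family {ν : ℕ → ℝ}
    {u₀ : ℕ → UnitAddTorus (Fin 3) → EuclideanSpace ℝ (Fin 3)}
    {u : ℕ → ℝ → UnitAddTorus (Fin 3) → EuclideanSpace ℝ (Fin 3)} {E : ℝ}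
    (hν : ∀ j, 0 < ν j) (hν₀ : Tendsto ν atTop (𝓝 0))
    (hu : ∀ j, Torus.IsGlobalLerayHopf (ν j) (fun _ => f) (u₀ j) (u j))
    (hf : IsSmooth f) (hf0 : HasZeroMean f) (hΨ : IsSmooth Ψ) (hΨdiv : IsDivFree Ψ)
    (hc0 : 0 ≤ c)
    (hc : ∀ (x : UnitAddTorus (Fin 3)) (v : EuclideanSpace ℝ (Fin 3)),
      -(c * ‖v‖ ^ 2) ≤ ⟪v, Torus.convect (fun _ => v) Ψ x⟫_ℝ)
    (hE : ∀ j, meanEnergy (u j) ≤ E) :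
    ∫ x, ⟪f x, Ψ x⟫_ℝ ≤ c * E := by
  set L := Real.sqrt (∫ x, ‖Torus.laplacian Ψ x‖ ^ 2) * Real.sqrt E with hL_def
  have hj : ∀ j, (∫ x, ⟪f x, Ψ x⟫_ℝ) ≤ c * E + ν j * L := fun j => by
    have h := forcePairing_le_of_meanEnergy_le (hu j) (hν j) hf hf0 hΨ hΨdiv hc0 hc (hE j)
    rw [hL_def, ← mul_assoc]
    exact h
  have ht : Tendsto (fun j => c * E + ν j * L) atTop (𝓝 (c * E)) := by
    simpa using tendsto_const_nhds.add (hν₀.mul_const L)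
  exact ge_of_tendsto' ht hj

/-- **The printed form** (Frobenius constant): the same with `c = M`, `|∇Ψ| ≤ M` pointwise.
[cite: DoeringFoias2002, §3] [cite: AlexakisDoering2006PLA, eq. (F1a)] -/
theorem forcePairing_le_frobenius_mul_of_family {ν : ℕ → ℝ}
    {u₀ : ℕ → UnitAddTorus (Fin 3) → EuclideanSpace ℝ (Fin 3)}
    {u : ℕ → ℝ → UnitAddTorus (Fin 3) → EuclideanSpace ℝ (Fin 3)} {E M : ℝ}
    (hν : ∀ j, 0 < ν j) (hν₀ : Tendsto ν atTop (𝓝 0))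
    (hu : ∀ j, Torus.IsGlobalLerayHopf (ν j) (fun _ => f) (u₀ j) (u j))
    (hf : IsSmooth f) (hf0 : HasZeroMean f) (hΨ : IsSmooth Ψ) (hΨdiv : IsDivFree Ψ)
    (hM : ∀ x, Real.sqrt (∑ i, ‖Torus.partialDeriv i Ψ x‖ ^ 2) ≤ M)
    (hE : ∀ j, meanEnergy (u j) ≤ E) :
    ∫ x, ⟪f x, Ψ x⟫_ℝ ≤ M * E :=
  forcePairing_le_strain_mul_of_family hν hν₀ hu hf hf0 hΨ hΨdiv
    ((Real.sqrt_nonneg _).trans (hM 0)) (semidefinite_of_frobenius hΨ hM) hE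

/-- **Self-pairing corollary**: with `Ψ = f` (divergence-free), `‖f‖₂² ≤ c(f) · E` along every
such family — `E ≥ ‖f‖₂² / c(f)`. [cite: DoeringFoias2002, §3] -/
theorem force_sq_le_strain_mul_energyBound_of_family {ν : ℕ → ℝ}
    {u₀ : ℕ → UnitAddTorus (Fin 3) → EuclideanSpace ℝ (Fin 3)}
    {u : ℕ → ℝ → UnitAddTorus (Fin 3) → EuclideanSpace ℝ (Fin 3)} {E : ℝ}
    (hν : ∀ j, 0 < ν j) (hν₀ : Tendsto ν atTop (𝓝 0))
    (hu : ∀ j, Torus.IsGlobalLerayHopf (ν j) (fun _ => f) (u₀ j) (u j))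
    (hf : IsSmooth f) (hfdiv : IsDivFree f) (hf0 : HasZeroMean f) (hc0 : 0 ≤ c)
    (hc : ∀ (x : UnitAddTorus (Fin 3)) (v : EuclideanSpace ℝ (Fin 3)),
      -(c * ‖v‖ ^ 2) ≤ ⟪v, Torus.convect (fun _ => v) f x⟫_ℝ)
    (hE : ∀ j, meanEnergy (u j) ≤ E) :
    ∫ x, ‖f x‖ ^ 2 ≤ c * E := by
  have h := forcePairing_le_strain_mul_of_family hν hν₀ hu hf hf0 hf hfdiv hc0 hc hE
  have hff : ∫ x, ⟪f x, f x⟫_ℝ = ∫ x, ‖f x‖ ^ 2 :=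
    integral_congr_ae (ae_of_all _ fun x => real_inner_self_eq_norm_sq (f x))
  rwa [hff] at h

end Summit.AnomalousDissipation.AnomalousDissipation.Theorems
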